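import Summits.CriticalPhenomena.CardyFormulaZ2.Theorems.CardyIKTransportIKMixedBoxCrossingTransportDefs
import Summits.CriticalPhenomena.CardyFormulaZ2.Theorems.CardyIKTransportIKLinearTransportStubDiagramExchange

/-!
# Stub `stub_cylExchange` (line `defect-closure-exploration`, reshape v4, crux stmt-CriticalPhenomena-5911)

The CYLINDER EXCHANGE `CylExchange` of the vocabulary file `…TransportDefs.lean`: on the cylinder slab
`Fin (w+1) × ℤ/L` with face types `τ`, swapping two adjacent face types `τ i ≠ τ (i+1)` does not change the
probability of an event determined off the cell column `i+1` (given the block diagram). Pure finite-sum algebra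
over the LANDED pinned Yang–Baxter identity `stub_DiagramExchange : ∀ L [NeZero L], 3 ≤ L → DiagramExchangeAt L`:

* the slab weight factorises as (faces off the face columns `i, i+1`) × (the sibling vocabulary's `blockWeight`
  of the three-column block at `i`), `cylWeight_split`; the off-block factor only sees the data off the cell
  column `i+1` / face columns `i, i+1` (`off_congr`) and not the swap (`off_swap`);
* summing a function of the block diagram against the block weight over the interior data of the block is
  summing it against `pinnedWeight` over diagrams (`pinned_sum`), and `DiagramExchangeAt L` swaps
  `![false, true] ↔ ![true, false]` (`pinned_swap`);
* on a fibre (fixed data off the column) membership in an `OffColDetermined` event is a function of the block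
  diagram (`mem_iff_exists`);
* the sum over slab configurations is re-indexed by (truncated configuration, middle column, block flags)
  through a glue map (`sum_reindex`, an explicit bijection), and on each fibre the restricted weight is
  (off weight) × `∑ Δ, g Δ * pinnedWeight L ![τ i, τ (i+1)] ξ ζ Δ`, hence swap invariant (`fibre_swap`);
* the same computation with `E = univ` gives the partition functions (`cylZ_eq`).

Design: this is a pure proof file (no definitions). The glue map is a section variable `glue` pinned by its
defining equation `hglue`; `stub_cylExchange` instantiates it with the explicit lambda.
-/

noncomputable section

namespace Summit.CriticalPhenomena.CardyFormulaZ2.Cruxes.IKMixedBoxCrossing.DefectClosureExploration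

open scoped BigOperators Classical
open Finset
open Summit.CriticalPhenomena.CardyFormulaZ2.Theorems.IKLinearTransport.PinnedDiagramExchange
  (faceWeight faceOdd blockWeight blockDiagram pinnedWeight DiagramExchangeAt stub_DiagramExchange)

namespace CylExchangeProof

variable {w L : ℕ}

/-! ## Factorisation of the slab weight -/

/-- A block face of the slab carries the sibling vocabulary's block face weight. -/
theorem face_term (τ : Fin w → Bool) (i : ℕ) (hi : i + 1 < w) (X : CylCfg w L) (j : Fin 2) (r : ZMod L) :
    faceWeight (τ ⟨i + j.val, by have := j.isLt; omega⟩)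
        (cylFaceOdd X.1 (⟨i + j.val, by have := j.isLt; omega⟩, r))
        (X.2 (⟨i + j.val, by have := j.isLt; omega⟩, r)) =
      faceWeight ((![τ ⟨i, by omega⟩, τ ⟨i + 1, hi⟩] : Fin 2 → Bool) j)
        (faceOdd L (blockCol i hi X) (j, r)) (blockFlg i hi X (j, r)) := by
  have hτ : τ ⟨i + j.val, by have := j.isLt; omega⟩ =
      (![τ ⟨i, by omega⟩, τ ⟨i + 1, hi⟩] : Fin 2 → Bool) j := by
    fin_cases j <;> rfl
  have hodd : cylFaceOdd X.1 (⟨i + j.val, by have := j.isLt; omega⟩, r) =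
      faceOdd L (blockCol i hi X) (j, r) := by
    simp only [cylFaceOdd, faceOdd, blockCol, Fin.val_castSucc, Fin.val_succ, Fin.castSucc_mk,
      Fin.succ_mk, Nat.add_assoc]
  rw [hτ, hodd]
  rfl

/-- FACTORISATION: slab weight = (weight of the faces off the face columns `i, i+1`) × (block weight of the
sibling vocabulary at the block `i`). -/
theorem cylWeight_split [NeZero L] (τ : Fin w → Bool) (i : ℕ) (hi : i + 1 < w) (X : CylCfg w L) :
    cylWeight w L τ X =
      (∏ f ∈ univ.filter (fun f : Fin w × ZMod L => ¬(f.1.val = i ∨ f.1.val = i + 1)),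
          faceWeight (τ f.1) (cylFaceOdd X.1 f) (X.2 f)) *
        blockWeight L ![τ ⟨i, by omega⟩, τ ⟨i + 1, hi⟩] (blockCol i hi X) (blockFlg i hi X) := by
  have hfilter : (univ.filter fun f : Fin w × ZMod L => f.1.val = i ∨ f.1.val = i + 1) =
      univ.image (fun g : Fin 2 × ZMod L =>
        ((⟨i + g.1.val, by have := g.1.isLt; omega⟩ : Fin w), g.2)) := by
    ext ⟨f1, f2⟩
    simp only [mem_filter, mem_univ, true_and, mem_image]
    constructor
    · rintro (h | h)
      · exact ⟨((0 : Fin 2), f2), Prod.ext (Fin.ext (by simp [h])) rfl⟩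
      · exact ⟨((1 : Fin 2), f2), Prod.ext (Fin.ext (by simp [h])) rfl⟩
    · rintro ⟨⟨j, r⟩, hjr⟩
      simp only [Prod.mk.injEq] at hjr
      obtain ⟨h1, rfl⟩ := hjr
      have hj := j.isLt
      rw [← h1]
      simp only
      omega
  have hinj : Set.InjOn (fun g : Fin 2 × ZMod L =>
      ((⟨i + g.1.val, by have := g.1.isLt; omega⟩ : Fin w), g.2)) ↑(univ : Finset (Fin 2 × ZMod L)) := by
    rintro ⟨j, r⟩ - ⟨j', r'⟩ - h
    simp only [Prod.mk.injEq, Fin.mk.injEq] at h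
    exact Prod.ext (Fin.ext (by simpa using h.1)) h.2
  unfold cylWeight blockWeight
  rw [← prod_filter_mul_prod_filter_not univ (fun f : Fin w × ZMod L => f.1.val = i ∨ f.1.val = i + 1),
    mul_comm]
  congr 1
  rw [hfilter, prod_image hinj]
  refine prod_congr rfl fun g _ => ?_
  obtain ⟨j, r⟩ := g
  exact face_term τ i hi X j r

/-- The off-block weight only sees the colours off the cell column `i+1` and the flags off the face columns
`i, i+1`. -/
theorem off_congr [NeZero L] (τ : Fin w → Bool) (i : ℕ) (X Y : CylCfg w L)
    (h1 : ∀ c : Fin (w + 1) × ZMod L, c.1.val ≠ i + 1 → X.1 c = Y.1 c)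
    (h2 : ∀ f : Fin w × ZMod L, f.1.val ≠ i → f.1.val ≠ i + 1 → X.2 f = Y.2 f) :
    (∏ f ∈ univ.filter (fun f : Fin w × ZMod L => ¬(f.1.val = i ∨ f.1.val = i + 1)),
        faceWeight (τ f.1) (cylFaceOdd X.1 f) (X.2 f)) =
      ∏ f ∈ univ.filter (fun f : Fin w × ZMod L => ¬(f.1.val = i ∨ f.1.val = i + 1)),
        faceWeight (τ f.1) (cylFaceOdd Y.1 f) (Y.2 f) := by
  refine prod_congr rfl fun f hf => ?_
  simp only [mem_filter, mem_univ, true_and, not_or] at hf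
  have ha : (Fin.castSucc f.1).val ≠ i + 1 := by simp [hf.2]
  have hb : (Fin.succ f.1).val ≠ i + 1 := by simp [hf.1]
  rw [h2 f hf.1 hf.2]
  simp only [cylFaceOdd]
  rw [h1 (Fin.castSucc f.1, f.2) ha, h1 (Fin.succ f.1, f.2) hb, h1 (Fin.castSucc f.1, f.2 + 1) ha,
    h1 (Fin.succ f.1, f.2 + 1) hb]

/-- The off-block weight does not see the swap of the face types `i, i+1`. -/
theorem off_swap [NeZero L] (τ : Fin w → Bool) (i : ℕ) (hi : i + 1 < w) (X : CylCfg w L) :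
    (∏ f ∈ univ.filter (fun f : Fin w × ZMod L => ¬(f.1.val = i ∨ f.1.val = i + 1)),
        faceWeight (τSwap i hi τ f.1) (cylFaceOdd X.1 f) (X.2 f)) =
      ∏ f ∈ univ.filter (fun f : Fin w × ZMod L => ¬(f.1.val = i ∨ f.1.val = i + 1)),
        faceWeight (τ f.1) (cylFaceOdd X.1 f) (X.2 f) := by
  refine prod_congr rfl fun f hf => ?_
  simp only [mem_filter, mem_univ, true_and, not_or] at hf
  have : τSwap i hi τ f.1 = τ f.1 := by
    simp only [τSwap, Function.comp]
    rw [Equiv.swap_apply_of_ne_of_ne]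
    · exact fun h => hf.1 (by rw [h])
    · exact fun h => hf.2 (by rw [h])
  rw [this]

/-! ## The pinned sum and the exchange -/

/-- PINNED SUM: summing a function of the block diagram against the block weight over the interior data of the
block is summing it against `pinnedWeight` over diagrams. -/
theorem pinned_sum [NeZero L] (τ2 : Fin 2 → Bool) (ξ ζ : ZMod L → Bool)
    (g : Set ((Fin 2 × ZMod L) × (Fin 2 × ZMod L)) → ℝ) :
    ∑ Δ : Set ((Fin 2 × ZMod L) × (Fin 2 × ZMod L)), g Δ * pinnedWeight L τ2 ξ ζ Δ =
      ∑ η : ZMod L → Bool, ∑ a : Fin 2 × ZMod L → Bool,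
        g (blockDiagram L (fun x => (![ξ, η, ζ] : Fin 3 → ZMod L → Bool) x.1 x.2) a) *
          blockWeight L τ2 (fun x => (![ξ, η, ζ] : Fin 3 → ZMod L → Bool) x.1 x.2) a := by
  simp only [pinnedWeight, Finset.mul_sum]
  rw [Finset.sum_comm]
  refine Finset.sum_congr rfl fun η _ => ?_
  rw [Finset.sum_comm]
  refine Finset.sum_congr rfl fun a _ => ?_
  simp_rw [mul_ite, mul_zero]
  simp only [Finset.sum_ite_eq, Finset.mem_univ, if_true]

/-- `DiagramExchangeAt` (the landed `stub_DiagramExchange`) as a swap of two distinct face types. -/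
theorem pinned_swap [NeZero L] (hL : 3 ≤ L) (b c : Bool) (hbc : b ≠ c) (ξ ζ : ZMod L → Bool)
    (Δ : Set ((Fin 2 × ZMod L) × (Fin 2 × ZMod L))) :
    pinnedWeight L ![b, c] ξ ζ Δ = pinnedWeight L ![c, b] ξ ζ Δ := by
  have h := stub_DiagramExchange L hL ξ ζ Δ
  cases b <;> cases c
  · rfl
  · exact h
  · exact h.symm
  · rfl

/-- On the fibre of `o` (same colours off the cell column `i+1`, same flags off the face columns `i, i+1`),
membership in an `OffColDetermined` event is a function of the block diagram. -/
theorem mem_iff_exists (i : ℕ) (hi : i + 1 < w) {E : Set (CylCfg w L)} (hE : OffColDetermined w L i hi E)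
    (o x : CylCfg w L) (h1 : ∀ c : Fin (w + 1) × ZMod L, c.1.val ≠ i + 1 → x.1 c = o.1 c)
    (h2 : ∀ f : Fin w × ZMod L, f.1.val ≠ i → f.1.val ≠ i + 1 → x.2 f = o.2 f) :
    x ∈ E ↔ ∃ y : CylCfg w L, (∀ c : Fin (w + 1) × ZMod L, c.1.val ≠ i + 1 → y.1 c = o.1 c) ∧
      (∀ f : Fin w × ZMod L, f.1.val ≠ i → f.1.val ≠ i + 1 → y.2 f = o.2 f) ∧
      blockDiag L i hi y = blockDiag L i hi x ∧ y ∈ E := by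
  refine ⟨fun h => ⟨x, h1, h2, rfl, h⟩, ?_⟩
  rintro ⟨y, hy1, hy2, hd, hy⟩
  exact (hE y x (fun c hc => (hy1 c hc).trans (h1 c hc).symm)
    (fun f hf1 hf2 => (hy2 f hf1 hf2).trans (h2 f hf1 hf2).symm) hd).1 hy

/-- The sure event is determined off every column. -/
theorem offColDetermined_univ (i : ℕ) (hi : i + 1 < w) : OffColDetermined w L i hi Set.univ :=
  fun _ _ _ _ _ => by simp

/-! ## The glue map and the fibre sums -/

section Glue

variable (i : ℕ) (hi : i + 1 < w)
  {glue : CylCfg w L → (ZMod L → Bool) → (Fin 2 × ZMod L → Bool) → CylCfg w L}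
  (hglue : ∀ (o : CylCfg w L) (η : ZMod L → Bool) (a : Fin 2 × ZMod L → Bool), glue o η a =
    ((fun c => if c.1.val = i + 1 then η c.2 else o.1 c),
     (fun f => if f.1.val = i then a (0, f.2) else if f.1.val = i + 1 then a (1, f.2) else o.2 f)))

include hglue

/-- A glued configuration has the colours of `o` off the cell column `i+1`. -/
theorem glue_fst (o : CylCfg w L) (η : ZMod L → Bool) (a : Fin 2 × ZMod L → Bool)
    (c : Fin (w + 1) × ZMod L) (hc : c.1.val ≠ i + 1) : (glue o η a).1 c = o.1 c := by
  simp [hglue, hc]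

/-- A glued configuration has the flags of `o` off the face columns `i, i+1`. -/
theorem glue_snd (o : CylCfg w L) (η : ZMod L → Bool) (a : Fin 2 × ZMod L → Bool)
    (f : Fin w × ZMod L) (h1 : f.1.val ≠ i) (h2 : f.1.val ≠ i + 1) : (glue o η a).2 f = o.2 f := by
  simp [hglue, h1, h2]

/-- The middle column of a glued configuration is the glued column. -/
theorem glue_mid (o : CylCfg w L) (η : ZMod L → Bool) (a : Fin 2 × ZMod L → Bool) (r : ZMod L) :
    (glue o η a).1 (⟨i + 1, by omega⟩, r) = η r := by
  simp [hglue]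

/-- The block flags of a glued configuration are the glued flags. -/
theorem blockFlg_glue (o : CylCfg w L) (η : ZMod L → Bool) (a : Fin 2 × ZMod L → Bool) :
    blockFlg i hi (glue o η a) = a := by
  funext ⟨j, r⟩
  fin_cases j <;> simp [blockFlg, hglue]

/-- The block colouring of a glued configuration: boundary columns `i, i+2` of `o`, middle column `η`. -/
theorem blockCol_glue (o : CylCfg w L) (η : ZMod L → Bool) (a : Fin 2 × ZMod L → Bool) :
    blockCol i hi (glue o η a) = fun x =>
      (![fun r => o.1 (⟨i, by omega⟩, r), η, fun r => o.1 (⟨i + 2, by omega⟩, r)] :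
        Fin 3 → ZMod L → Bool) x.1 x.2 := by
  funext ⟨j, r⟩
  fin_cases j <;> simp [blockCol, hglue]

/-- The block diagram of a glued configuration is the sibling vocabulary's `blockDiagram`. -/
theorem blockDiag_glue (o : CylCfg w L) (η : ZMod L → Bool) (a : Fin 2 × ZMod L → Bool) :
    blockDiag L i hi (glue o η a) = blockDiagram L (fun x =>
      (![fun r => o.1 (⟨i, by omega⟩, r), η, fun r => o.1 (⟨i + 2, by omega⟩, r)] :
        Fin 3 → ZMod L → Bool) x.1 x.2) a := by
  rw [blockDiag, blockCol_glue i hi hglue, blockFlg_glue i hi hglue]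

include hi in
/-- RE-INDEXING: a sum over slab configurations is a sum over (truncated configuration, middle column,
block flags) through the glue map. -/
theorem sum_reindex [NeZero L] : ∃ T : Finset (CylCfg w L), ∀ F : CylCfg w L → ℝ,
    ∑ x, F x = ∑ o ∈ T, ∑ η : ZMod L → Bool, ∑ a : Fin 2 × ZMod L → Bool, F (glue o η a) := by
  have hlt1 : i + 1 < w + 1 := by omega
  have hlt0 : i < w := by omega
  obtain ⟨trunc, htrunc⟩ : ∃ trunc : CylCfg w L → CylCfg w L, ∀ x, trunc x =
      ((fun c => if c.1.val = i + 1 then false else x.1 c),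
       (fun f => if f.1.val = i ∨ f.1.val = i + 1 then false else x.2 f)) := ⟨_, fun _ => rfl⟩
  have trunc_glue : ∀ o η a, trunc (glue o η a) = trunc o := fun o η a => by
    refine Prod.ext (funext fun c => ?_) (funext fun f => ?_)
    · simp only [htrunc, hglue]
      split_ifs <;> rfl
    · simp only [htrunc, hglue]
      split_ifs <;> simp_all
  have trunc_trunc : ∀ x, trunc (trunc x) = trunc x := fun x => by
    refine Prod.ext (funext fun c => ?_) (funext fun f => ?_)
    · simp only [htrunc]
      split_ifs <;> rfl
    · simp only [htrunc]
      split_ifs <;> rfl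
  have glue_trunc : ∀ x : CylCfg w L,
      glue (trunc x) (fun r => x.1 (⟨i + 1, hlt1⟩, r)) (blockFlg i hi x) = x := fun x => by
    refine Prod.ext (funext fun c => ?_) (funext fun f => ?_)
    · obtain ⟨c1, c2⟩ := c
      by_cases h : c1.val = i + 1
      · rw [show c1 = ⟨i + 1, hlt1⟩ from Fin.ext h]
        simp [hglue]
      · simp [hglue, htrunc, h]
    · obtain ⟨f1, f2⟩ := f
      by_cases h1 : f1.val = i
      · rw [show f1 = ⟨i, hlt0⟩ from Fin.ext h1]
        simp [hglue, blockFlg]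
      · by_cases h2 : f1.val = i + 1
        · rw [show f1 = ⟨i + 1, hi⟩ from Fin.ext h2]
          simp [hglue, blockFlg]
        · simp [hglue, htrunc, h1, h2]
  refine ⟨univ.filter fun o => trunc o = o, fun F => ?_⟩
  rw [← sum_product', ← sum_product']
  symm
  refine sum_nbij' (fun q => glue q.1.1 q.1.2 q.2)
    (fun x => ((trunc x, fun r => x.1 (⟨i + 1, hlt1⟩, r)), blockFlg i hi x)) ?_ ?_ ?_ ?_ ?_
  · intro q _
    exact mem_univ _
  · intro x _
    simp only [mem_product, mem_filter, mem_univ, true_and, and_true]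
    exact trunc_trunc x
  · rintro ⟨⟨o, η⟩, a⟩ hq
    simp only [mem_product, mem_filter, mem_univ, true_and, and_true] at hq
    simp only [Prod.mk.injEq]
    exact ⟨⟨(trunc_glue o η a).trans hq, funext fun r => glue_mid i hi hglue o η a r⟩,
      blockFlg_glue i hi hglue o η a⟩
  · intro x _
    exact glue_trunc x
  · intro q _
    rfl

/-- FIBRE SWAP: the restricted weight of the fibre of `o` is (off-block weight) × (diagram indicator against
`pinnedWeight L ![τ i, τ (i+1)]`), hence invariant under the swap of two distinct adjacent face types. -/
theorem fibre_swap [NeZero L] (hL : 3 ≤ L) (τ : Fin w → Bool) (hτ : τ ⟨i, by omega⟩ ≠ τ ⟨i + 1, hi⟩)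
    {E : Set (CylCfg w L)} (hE : OffColDetermined w L i hi E) (o : CylCfg w L) :
    ∑ η : ZMod L → Bool, ∑ a : Fin 2 × ZMod L → Bool,
        (if glue o η a ∈ E then cylWeight w L τ (glue o η a) else 0) =
      ∑ η : ZMod L → Bool, ∑ a : Fin 2 × ZMod L → Bool,
        (if glue o η a ∈ E then cylWeight w L (τSwap i hi τ) (glue o η a) else 0) := by
  obtain ⟨OFF, hOFF⟩ : ∃ OFF : (Fin w → Bool) → ℝ, ∀ σ, OFF σ =
      ∏ f ∈ univ.filter (fun f : Fin w × ZMod L => ¬(f.1.val = i ∨ f.1.val = i + 1)),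
        faceWeight (σ f.1) (cylFaceOdd o.1 f) (o.2 f) := ⟨_, fun _ => rfl⟩
  obtain ⟨GE, hGE⟩ : ∃ GE : Set ((Fin 2 × ZMod L) × (Fin 2 × ZMod L)) → ℝ,
      ∀ (η : ZMod L → Bool) (a : Fin 2 × ZMod L → Bool) (W : ℝ),
        (if glue o η a ∈ E then W else 0) = GE (blockDiag L i hi (glue o η a)) * W := by
    refine ⟨fun Δ => if ∃ y : CylCfg w L, (∀ c : Fin (w + 1) × ZMod L, c.1.val ≠ i + 1 → y.1 c = o.1 c) ∧
        (∀ f : Fin w × ZMod L, f.1.val ≠ i → f.1.val ≠ i + 1 → y.2 f = o.2 f) ∧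
        blockDiag L i hi y = Δ ∧ y ∈ E then 1 else 0, fun η a W => ?_⟩
    have hiff := mem_iff_exists i hi hE o (glue o η a) (glue_fst i hglue o η a) (glue_snd i hglue o η a)
    dsimp only
    by_cases h : glue o η a ∈ E
    · rw [if_pos h, if_pos (hiff.1 h), one_mul]
    · rw [if_neg h, if_neg (mt hiff.2 h), zero_mul]
  have key : ∀ σ : Fin w → Bool,
      ∑ η : ZMod L → Bool, ∑ a : Fin 2 × ZMod L → Bool,
          (if glue o η a ∈ E then cylWeight w L σ (glue o η a) else 0) =
        OFF σ * ∑ Δ : Set ((Fin 2 × ZMod L) × (Fin 2 × ZMod L)),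
          GE Δ * pinnedWeight L ![σ ⟨i, by omega⟩, σ ⟨i + 1, hi⟩]
            (fun r => o.1 (⟨i, by omega⟩, r)) (fun r => o.1 (⟨i + 2, by omega⟩, r)) Δ := by
    intro σ
    rw [pinned_sum, Finset.mul_sum]
    refine Finset.sum_congr rfl fun η _ => ?_
    rw [Finset.mul_sum]
    refine Finset.sum_congr rfl fun a _ => ?_
    rw [hGE η a, cylWeight_split σ i hi,
      off_congr σ i (glue o η a) o (glue_fst i hglue o η a) (glue_snd i hglue o η a),
      blockCol_glue i hi hglue, blockFlg_glue i hi hglue, blockDiag_glue i hi hglue, hOFF]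
    ring
  rw [key τ, key (τSwap i hi τ), hOFF, hOFF, off_swap τ i hi o]
  congr 1
  refine Finset.sum_congr rfl fun Δ _ => ?_
  have h1 : τSwap i hi τ ⟨i, by omega⟩ = τ ⟨i + 1, hi⟩ := by
    simp [τSwap, Equiv.swap_apply_left]
  have h2 : τSwap i hi τ ⟨i + 1, hi⟩ = τ ⟨i, by omega⟩ := by
    simp [τSwap, Equiv.swap_apply_right]
  rw [h1, h2, pinned_swap hL _ _ hτ]

/-- The numerator of `cylProb` is invariant under the swap. -/
theorem numer_eq [NeZero L] (hL : 3 ≤ L) (τ : Fin w → Bool) (hτ : τ ⟨i, by omega⟩ ≠ τ ⟨i + 1, hi⟩)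
    (E : Set (CylCfg w L)) (hE : OffColDetermined w L i hi E) :
    ∑ x : CylCfg w L, (if x ∈ E then cylWeight w L τ x else 0) =
      ∑ x : CylCfg w L, (if x ∈ E then cylWeight w L (τSwap i hi τ) x else 0) := by
  obtain ⟨T, hT⟩ := sum_reindex i hi hglue
  rw [hT (fun x => if x ∈ E then cylWeight w L τ x else 0),
    hT (fun x => if x ∈ E then cylWeight w L (τSwap i hi τ) x else 0)]
  exact Finset.sum_congr rfl fun o _ => fibre_swap i hi hglue hL τ hτ hE o

/-- The partition function is invariant under the swap. -/
theorem cylZ_eq [NeZero L] (hL : 3 ≤ L) (τ : Fin w → Bool) (hτ : τ ⟨i, by omega⟩ ≠ τ ⟨i + 1, hi⟩) :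
    cylZ w L τ = cylZ w L (τSwap i hi τ) := by
  have h := numer_eq i hi hglue hL τ hτ Set.univ (offColDetermined_univ i hi)
  simpa [cylZ] using h

end Glue

end CylExchangeProof

/-- STUB `stub_cylExchange` of the line `defect-closure-exploration` (reshape v4): the CYLINDER EXCHANGE. Swapping
two adjacent face types of different kind does not change the probability of an event determined off the cell
column between them; algebra over the landed pinned Yang–Baxter identity `stub_DiagramExchange`. -/
theorem stub_cylExchange : CylExchange := by
  intro w L _ hL τ i hi hτ E hE
  unfold cylProb
  rw [CylExchangeProof.numer_eq i hi (fun _ _ _ => rfl) hL τ hτ E hE,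
    CylExchangeProof.cylZ_eq i hi (fun _ _ _ => rfl) hL τ hτ]

end Summit.CriticalPhenomena.CardyFormulaZ2.Cruxes.IKMixedBoxCrossing.DefectClosureExploration

end
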